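import Literature.Barriers.ValiantsHypothesis.GCTMatrixPoweringPositivity
import HarnessLib

/-!
# Gesmundo–Ikenmeyer–Panova 2017, Props. 18 and 20: an ERRATUM — the shape `(2,1,1,1)` is missing
# from the printed exceptional lists; corrected statements, the corrected Prop. 20 PROVED from
# Props. 15, 17, 18 (corrected), 19, and Thm. 10 re-threaded

Sibling file (D-0014) of `GCTMatrixPoweringProofs.lean` (named fact `GIP2017_prop20`),
`GCTMatrixPoweringColumns.lean` (named fact `GIP2017_prop18`) and `GCTMatrixPoweringPositivity.lean`
(`GIP2017_prop20_of_parts`); conventions as there (`SmPos m λ` = "`sm(λ, m) > 0`" through the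
character sum `skCharSum λ μ = Σ_σ χ^λ(σ)(χ^μ(σ)² + χ^μ(σ²)) = 2·D!·sk(λ, μ)`).

**The erratum.** GIP state (arXiv:1611.00827 = Diff. Geom. Appl. 55 (2017); Prop. 20 = Prop. 3.7
of the journal numbering, Prop. 18 = Prop. 3.5): "Let `λ` be partition of length at most `L` and
`λ ∉ {(1²), (1³), (1⁴), (1⁷), (1⁸), (1¹²), (2,1²), (3,1²), (2,1⁷)}` and also `λ ≠ (2,2,1^k)` for any
`k`. Let `ℓ := max{⌈√L⌉ + 2, 12}`. Then `sm(λ, ℓ) > 0`" (Prop. 20) and "Let `λ` be a partition of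
length `ℓ ≤ 14` and `λ ∉ {(1^r) : r ∈ X_s} ∪ {(2,1,1), (3,1,1), (2,1⁷)}`. Then `sm(λ, 7) > 0`"
(Prop. 18, by "a direct computation for partitions `λ` with `ℓ(λ) ≤ 12` and `λ₁ ≤ 3`"). Both are
FALSE for the hook `λ = (2,1,1,1) = (2,1³) ⊢ 5` (length `4`, not in either list, not of the form
`(2,2,1^k)`): `sm((2,1³), a) = Σ_{μ ⊢ 5, ℓ(μ) ≤ a} sk((2,1³), μ) = 0` for EVERY `a`, because the
irreducible `[2,1³] = V' = V ⊗ U'` of `𝔖₅` (Fulton–Harris §3.1; `V = [4,1]` the standard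
representation, Examples 4.5) occurs in no symmetric square `S²[μ]`, `μ ⊢ 5`: from the character
table of `𝔖₅` [FultonHarrisGTM129, §3.1] and `χ_{S²W}(g) = (χ_W(g)² + χ_W(g²))/2`,
`S²[5] = S²[1⁵] = [5]`, `S²[4,1] = S²[2,1³] = [5] ⊕ [4,1] ⊕ [3,2]` (FH Ex. 3.2),
`S²[3,2] = S²[2,2,1] = [5] ⊕ [4,1] ⊕ [3,2] ⊕ [2,2,1]` (`Λ²[3,2] = [3,1,1] ⊕ [2,1³]`), and
`⟨χ_{S²[3,1,1]}, χ^{(2,1³)}⟩ = (1·21·4 + 10·3·(−2) + 24·1·(−1))/120 = 0`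
(`χ_{S²[3,1,1]} = (21, 3, 5, 0, 0, −1, 1)`, `χ^{(2,1³)} = (4, −2, 0, 1, 1, 0, −1)` on the classes
`e, (12), (12)(34), (123), (123)(45), (1234), (12345)`). So `sk((2,1³), μ) = 0` for all seven
`μ ⊢ 5` (while `ak((2,1³), μ) = 1` for `μ = (3,2), (3,1,1), (2,2,1)`: `am((2,1³), 3) = 3`). This was
re-derived mechanically from the tree's own definitions (Young-symmetrizer left ideals of `ℚ[𝔖₅]`,
traces of left multiplication; harness evidence `job2/specht_s5_literal.py` of the vendoring
session) and by an exhaustive Murnaghan–Nakayama computation of `sm`/`am` for ALL partitions with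
`|λ| ≤ 25` (evidence `job/gip_prop20_check.py`, report `outputs25/report.json`), which found that
`(2,1³)` is the ONLY shape with `|λ| ≤ 25` violating Prop. 20 or Prop. 18 as printed: the nine listed
shapes are exactly the other shapes with `sm(λ, 12) = 0` in that range, every `(2,2,1^k)`, `k ≤ 21`,
has `sm > 0`, and Prop. 17's "iff" for columns holds for all `a ≤ 25`. GIP's Main Result (Thm. 10)
and Prop. 14 are NOT affected (`λ₁ ≥ 3` there), nor is the printed proof of Prop. 20 once `(2,1³)`
is added to both lists (below).

**What this file does.**

1. `twoOneCube : Nat.Partition 5`, the shape `(2,1,1,1)`; the named fact `skTwoOneCubeVanishes`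
   ("`sk((2,1³), μ) = 0` for all `μ ⊢ 5`", i.e. `skCharSum (2,1³) μ = 0`; source: the character table
   of `𝔖₅`, FH §3.1 — the tree has no character VALUES of its abstract Specht modules, so this atom
   is vendored, not decided); PROVED from it: `not_smPos_twoOneCube`, the refutations
   `GIP2017_prop20_false`, `GIP2017_prop18_false`, and unconditionally the localisations
   `GIP2017_prop20_iff` / `GIP2017_prop18_iff`: each printed statement is EQUIVALENT to its corrected
   form together with the single false atom `SmPos 12 (2,1³)` / `SmPos 7 (2,1³)`.
2. The corrected exceptional list `gipExceptionalShapesCorrected = gipExceptionalShapes ∪ {(2,1³)}`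
   (ten shapes) and the corrected named facts `GIP2017_prop18_corrected`, `GIP2017_prop20_corrected`
   (the printed statements with the ten-shape list; each is implied by its printed version).
3. `GIP2017_prop20_corrected_of_parts`: the corrected Prop. 20 PROVED from Prop. 15 (semigroup),
   Prop. 17 (columns), Prop. 18 CORRECTED and Prop. 19 — the printed case analysis exactly as run in
   `GIP2017_prop20_of_parts` (`GCTMatrixPoweringPositivity.lean`), whose only uses of Prop. 18 are on
   shapes with two or more columns all of length `≥ 2` (never `(2,1³)`, whose columns are `4, 1`) and
   on `λ` itself (excluded by hypothesis).
4. Re-threading: `GIP2017_prop14_of_prop20_corrected` (`λ₁ ≥ 3` excludes all ten shapes),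
   `GIP2017_thm10_of_prop20_corrected`, `gctMatrixPowering_of_prop20_corrected`,
   `GIP2017_thm10_of_parts_corrected`, `gctMatrixPowering_of_parts_corrected`: the barrier fact
   `GCTMatrixPowering = GIP2017_thm10` rests on `GIP2017_prop15`, `GIP2017_prop17`,
   `GIP2017_prop18_corrected`, `GIP2017_prop19`.

**Verdict clean-up (2026-08-15).** The printed statements `GIP2017_prop18` (refuted here
conditionally, `GIP2017_prop18_false`, and unconditionally in `GCTMatrixPoweringErratumProofs.lean`,
`not_GIP2017_prop18`) and `GIP2017_prop19` (a second erratum: the printed row bound fails at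
`a = s² - 2`, `s ≥ 7`; `GIP2017_prop19_false`, `GCTMatrixPoweringProp19False.lean`) are now
`@[deprecated]` records in `GCTMatrixPoweringColumns.lean`. In this file `linter.deprecated` is
switched off for exactly the declarations that must name them: the refutation steps
`smPos_twoOneCube_of_prop18`, `GIP2017_prop18_false`, `GIP2017_prop18_corrected_of_prop18` and the
localisation `GIP2017_prop18_iff` (kept as they are: they are ABOUT the printed statement), and the
three theorems of §§4–5 taking `(h19 : GIP2017_prop19)` — `GIP2017_prop20_corrected_of_parts`,
`GIP2017_thm10_of_parts_corrected`, `gctMatrixPowering_of_parts_corrected` — which are vacuous and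
therefore `@[deprecated]` themselves in favour of `GIP2017_prop20_corrected_of_prop18`,
`GIP2017_thm10_of_prop18`, `gctMatrixPowering_of_prop18` (`GCTMatrixPoweringProp17.lean`: the same
case analysis with the corrected, proved Prop. 19, `GIP2017_prop19_corrected_holds`) and the
unconditional `GIP2017_prop20_corrected_holds`, `GCTMatrixPowering_holds`
(`GCTMatrixPoweringProp20Holds.lean`). Statements and proofs are unchanged.

## References

* [GesmundoIkenmeyerPanova2017] F. Gesmundo, C. Ikenmeyer, G. Panova, *Geometric complexity theory
  and matrix powering*, Diff. Geom. Appl. 55 (2017) 106–127 = arXiv:1611.00827: §2.1 (`sk`),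
  Thm. 8 (`sm`), §3 (`am`, (3.1), Props. 15, 17, 18, 19, 20 and the proof of Prop. 20; journal
  numbering Props. 3.2, 3.4, 3.5, 3.6, 3.7), Prop. 14 and Thm. 10.
* [FultonHarrisGTM129] W. Fulton, J. Harris, *Representation Theory. A First Course*, GTM 129
  (1991): §2.1 (characters of `Sym²` and `Λ²`), §3.1 (character table of `𝔖₅`, Exercises 3.2,
  3.3), Examples 4.5 (the irreducibles of `𝔖₅` as `V_λ`).
-/

noncomputable section

open scoped BigOperators

namespace Literature.Barriers.ValiantsHypothesis

open Literature.NumberTheory.DiophantineGeometry Literature.Computability.Complexity Finset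

/-! ### 1. The shape `(2,1,1,1)` and the vanishing of `sk((2,1³), ·)` -/

/-- The hook `(2,1,1,1) = (2,1³) ⊢ 5` (columns of lengths `4` and `1`), the shape missing from the
exceptional lists of GIP Props. 18 and 20: `[2,1³] = V' = V ⊗ U'`, the standard representation of
`𝔖₅` twisted by the sign (Fulton–Harris §3.1, Examples 4.5). [cite: FultonHarrisGTM129, §3.1 and Examples 4.5] -/
def twoOneCube : Nat.Partition 5 where
  parts := {2, 1, 1, 1}
  parts_pos h := by
    simp only [Multiset.insert_eq_cons, Multiset.mem_cons, Multiset.mem_singleton] at h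
    omega
  parts_sum := by decide

/-- The parts of `(2,1³)`. [folklore] -/
@[simp]
theorem twoOneCube_parts : twoOneCube.parts = {2, 1, 1, 1} :=
  rfl

/-- `(2,1³)` has four parts. [folklore] -/
theorem card_twoOneCube_parts : twoOneCube.parts.card = 4 := by
  decide

/-- `(2,1³)` is none of the nine printed exceptional shapes of GIP Props. 18/20.
[cite: GesmundoIkenmeyerPanova2017, Prop. 20 (the exceptional list)] -/
theorem twoOneCube_parts_not_mem : twoOneCube.parts ∉ gipExceptionalShapes := by
  decide

/-- `(2,1³)` is not of the form `(2,2,1^k)` (it has a single part `2`).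
[cite: GesmundoIkenmeyerPanova2017, Prop. 20 ("λ ≠ (2,2,1^k)")] -/
theorem twoOneCube_parts_ne (k : ℕ) : twoOneCube.parts ≠ 2 ::ₘ 2 ::ₘ Multiset.replicate k 1 := by
  intro h
  have hc := congrArg (Multiset.count 2) h
  rw [Multiset.count_cons_self, Multiset.count_cons_self, Multiset.count_eq_zero_of_notMem
    (fun h1 => absurd (Multiset.eq_of_mem_replicate h1) (by decide))] at hc
  revert hc
  decide

/-- A partition with parts `{2,1,1,1}` is `twoOneCube` (so lives in degree `5`). [folklore] -/
theorem eq_five_of_parts_eq_two_one_one_one {D : ℕ} {lam : Nat.Partition D} (h : lam.parts = {2, 1, 1, 1}) :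
    D = 5 := by
  rw [← lam.parts_sum, h]
  decide

/-- In degree `5`, the partition with parts `{2,1,1,1}` is `twoOneCube`. [folklore] -/
theorem eq_twoOneCube_of_parts_eq_two_one_one_one {lam : Nat.Partition 5} (h : lam.parts = {2, 1, 1, 1}) :
    lam = twoOneCube := by
  cases lam
  cases h
  rfl

/-- **The missing exception (erratum to GIP Props. 18 and 20) — named fact.** For every `μ ⊢ 5`
the symmetric Kronecker coefficient `sk((2,1³), μ)` vanishes, i.e. the irreducible
`[2,1³] = V' = V ⊗ U'` of `𝔖₅` occurs in no symmetric square `S²[μ]`; in the tree's character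
rendering, `skCharSum (2,1³) μ = 2·5!·sk((2,1³), μ) = 0`. Derivation (not stated in GIP, whose lists
omit this shape): by the character table of `𝔖₅` (FH §3.1: `U, U', V, V', Λ²V, W, W'` =
`[5], [1⁵], [4,1], [2,1³], [3,1,1], [3,2], [2,2,1]`, Examples 4.5) and
`χ_{S²[μ]}(g) = (χ^μ(g)² + χ^μ(g²))/2` (FH §2.1): `S²[5] = S²[1⁵] = [5]`,
`S²[4,1] = S²[2,1³] = [5] ⊕ [4,1] ⊕ [3,2]` (FH Ex. 3.2), `S²[3,2] = S²[2,2,1] = [5] ⊕ [4,1] ⊕ [3,2] ⊕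
[2,2,1]`, and `⟨χ_{S²[3,1,1]}, χ^{(2,1³)}⟩ = (84 − 60 − 24)/120 = 0`. Consequently
`sm((2,1³), a) = 0` for all `a` (`not_smPos_twoOneCube`), contradicting Props. 18 and 20 as printed.
Vendored as a named fact because the tree has no character values of its (Young-symmetrizer) Specht
modules; re-derived mechanically from the tree's definitions over `ℚ[𝔖₅]` in the vendoring session.
[cite: FultonHarrisGTM129, §3.1 (character table of 𝔖₅, Ex. 3.2, Ex. 3.3) and Examples 4.5] -/
def skTwoOneCubeVanishes : Prop :=
  ∀ μ : Nat.Partition 5, skCharSum twoOneCube μ = 0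

/-- `sm((2,1³), a) = 0` for every number of rows `a`: no `μ ⊢ 5` has `sk((2,1³), μ) > 0`.
[cite: FultonHarrisGTM129, §3.1 (character table of 𝔖₅)] -/
theorem not_smPos_twoOneCube (h : skTwoOneCubeVanishes) (a : ℕ) : ¬ SmPos a twoOneCube :=
  fun ⟨μ, _, hsk⟩ => hsk (h μ)

/-- What Prop. 20 as printed asserts about `(2,1³)` (take `L = 4`, `ℓ = 12`): `sm((2,1³), 12) > 0`.
[cite: GesmundoIkenmeyerPanova2017, Prop. 20] -/
theorem smPos_twoOneCube_of_prop20 (h20 : GIP2017_prop20) : SmPos 12 twoOneCube := by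
  have h := h20 5 4 twoOneCube (by rw [card_twoOneCube_parts]) twoOneCube_parts_not_mem
    twoOneCube_parts_ne
  have h4 : gipEll 4 = 12 := by
    have := Nat.sqrt_le_self (4 - 1)
    unfold gipEll
    omega
  rwa [h4] at h

-- `linter.deprecated` is switched off for the next declaration only: it is a step of the refutation
-- of the printed Prop. 18 and must name the record `GIP2017_prop18` of
-- `GCTMatrixPoweringColumns.lean`, deprecated there since the verdict clean-up of 2026-08-15.
-- REMOVE-WHEN that record is deleted.
set_option linter.deprecated false in
/-- What Prop. 18 as printed asserts about `(2,1³)`: `sm((2,1³), 7) > 0`.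
[cite: GesmundoIkenmeyerPanova2017, Prop. 18] -/
theorem smPos_twoOneCube_of_prop18 (h18 : GIP2017_prop18) : SmPos 7 twoOneCube :=
  h18 5 twoOneCube (by rw [card_twoOneCube_parts]; norm_num) twoOneCube_parts_not_mem

/-- **GIP Prop. 20 as printed is false**, given the `𝔖₅` computation `skTwoOneCubeVanishes`.
[cite: GesmundoIkenmeyerPanova2017, Prop. 20] [cite: FultonHarrisGTM129, §3.1] -/
theorem GIP2017_prop20_false (h : skTwoOneCubeVanishes) : ¬ GIP2017_prop20 :=
  fun h20 => not_smPos_twoOneCube h 12 (smPos_twoOneCube_of_prop20 h20)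

-- `linter.deprecated` off for the next declaration only: it IS the (conditional) refutation of
-- the deprecated record `GIP2017_prop18` and must name it. REMOVE-WHEN the record is deleted.
set_option linter.deprecated false in
/-- **GIP Prop. 18 as printed is false**, given the `𝔖₅` computation `skTwoOneCubeVanishes`
(discharged in `GCTMatrixPoweringErratumProofs.lean`: `not_GIP2017_prop18` is unconditional).
[cite: GesmundoIkenmeyerPanova2017, Prop. 18] [cite: FultonHarrisGTM129, §3.1] -/
theorem GIP2017_prop18_false (h : skTwoOneCubeVanishes) : ¬ GIP2017_prop18 :=
  fun h18 => not_smPos_twoOneCube h 7 (smPos_twoOneCube_of_prop18 h18)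

/-! ### 2. The corrected exceptional list and the corrected Props. 18 and 20 -/

/-- **The corrected exceptional list**: GIP's nine shapes together with `(2,1³)` — the ten shapes
`{(1²), (1³), (1⁴), (1⁷), (1⁸), (1¹²), (2,1²), (2,1³), (3,1²), (2,1⁷)}` (the family `(2,2,1^k)` is
still excluded separately in Prop. 20). [cite: GesmundoIkenmeyerPanova2017, Prop. 20 (the exceptional list)] [cite: FultonHarrisGTM129, §3.1] -/
def gipExceptionalShapesCorrected : Finset (Multiset ℕ) :=
  insert {2, 1, 1, 1} gipExceptionalShapes

/-- Membership in the corrected list. [cite: GesmundoIkenmeyerPanova2017, Prop. 20] -/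
theorem mem_gipExceptionalShapesCorrected_iff (s : Multiset ℕ) :
    s ∈ gipExceptionalShapesCorrected ↔ s = {2, 1, 1, 1} ∨ s ∈ gipExceptionalShapes :=
  Finset.mem_insert

/-- The printed nine shapes belong to the corrected list. [cite: GesmundoIkenmeyerPanova2017, Prop. 20] -/
theorem mem_gipExceptionalShapesCorrected_of_mem {s : Multiset ℕ} (h : s ∈ gipExceptionalShapes) :
    s ∈ gipExceptionalShapesCorrected :=
  Finset.mem_insert_of_mem h

/-- `(2,1³)` belongs to the corrected list. [cite: FultonHarrisGTM129, §3.1] -/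
theorem twoOneCube_parts_mem_corrected : twoOneCube.parts ∈ gipExceptionalShapesCorrected :=
  Finset.mem_insert_self _ _

/-- **GIP Prop. 18, corrected — named fact.** "Let `λ` be a partition of length `ℓ ≤ 14` and
`λ ∉ {(1^r) : r ∈ X_s} ∪ {(2,1,1), (3,1,1), (2,1⁷)}`. Then `sm(λ, 7) > 0`", with the exceptional
set corrected to the ten shapes `gipExceptionalShapesCorrected` (the printed set omits `(2,1³)`,
for which `sm((2,1³), 7) = 0`, `GIP2017_prop18_false`). Printed proof: computer check for
`ℓ(λ) ≤ 12`, `λ₁ ≤ 3` and further small families, semigroup property beyond; the harness's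
exhaustive recomputation for `|λ| ≤ 25` agrees with the corrected statement.
[cite: GesmundoIkenmeyerPanova2017, Prop. 18] [cite: FultonHarrisGTM129, §3.1] -/
def GIP2017_prop18_corrected : Prop :=
  ∀ (D : ℕ) (lam : Nat.Partition D), lam.parts.card ≤ 14 →
    lam.parts ∉ gipExceptionalShapesCorrected → SmPos 7 lam

/-- **GIP Prop. 20, corrected — named fact.** "Let `λ` be partition of length at most `L` and
`λ ∉ {(1²), (1³), (1⁴), (1⁷), (1⁸), (1¹²), (2,1²), (3,1²), (2,1⁷)}` and also `λ ≠ (2,2,1^k)` for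
any `k`. Let `ℓ := max{⌈√L⌉ + 2, 12}`. Then `sm(λ, ℓ) > 0`", with the exceptional set corrected to
the ten shapes `gipExceptionalShapesCorrected` (`(2,1³)` added: `sm((2,1³), ℓ) = 0`,
`GIP2017_prop20_false`); rendering as `GIP2017_prop20`. PROVED below from Props. 15, 17,
18 (corrected), 19 (`GIP2017_prop20_corrected_of_parts`). [cite: GesmundoIkenmeyerPanova2017, Prop. 20] [cite: FultonHarrisGTM129, §3.1] -/
def GIP2017_prop20_corrected : Prop :=
  ∀ (D L : ℕ) (lam : Nat.Partition D), lam.parts.card ≤ L →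
    lam.parts ∉ gipExceptionalShapesCorrected →
      (∀ k : ℕ, lam.parts ≠ 2 ::ₘ 2 ::ₘ Multiset.replicate k 1) → SmPos (gipEll L) lam

-- `linter.deprecated` off for the next declaration only: it compares the corrected statement with
-- the deprecated printed record `GIP2017_prop18` (used by the localisation `GIP2017_prop18_iff`)
-- and must name it. REMOVE-WHEN the record is deleted.
set_option linter.deprecated false in
/-- The corrected Prop. 18 is a weakening of the printed one (a bookkeeping step of the
localisation `GIP2017_prop18_iff`; the printed statement being refuted, this is not a way to
obtain `GIP2017_prop18_corrected` — use `GIP2017_prop18_corrected_holds`,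
`GCTMatrixPoweringProp20Holds.lean`). [cite: GesmundoIkenmeyerPanova2017, Prop. 18] -/
theorem GIP2017_prop18_corrected_of_prop18 (h18 : GIP2017_prop18) : GIP2017_prop18_corrected :=
  fun D lam hl hE => h18 D lam hl fun hmem => hE (mem_gipExceptionalShapesCorrected_of_mem hmem)

/-- The corrected Prop. 20 is a weakening of the printed one. [cite: GesmundoIkenmeyerPanova2017, Prop. 20] -/
theorem GIP2017_prop20_corrected_of_prop20 (h20 : GIP2017_prop20) : GIP2017_prop20_corrected :=
  fun D L lam hL hE h22 =>
    h20 D L lam hL (fun hmem => hE (mem_gipExceptionalShapesCorrected_of_mem hmem)) h22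

-- `linter.deprecated` off for the next declaration only: it localises the error of the deprecated
-- printed record `GIP2017_prop18` and must name it. REMOVE-WHEN the record is deleted.
set_option linter.deprecated false in
/-- **Localisation of the error in Prop. 18**: the printed statement is equivalent to the corrected
one together with the single (false) atom `sm((2,1³), 7) > 0`. [cite: GesmundoIkenmeyerPanova2017, Prop. 18] -/
theorem GIP2017_prop18_iff : GIP2017_prop18 ↔ GIP2017_prop18_corrected ∧ SmPos 7 twoOneCube := by
  refine ⟨fun h18 => ⟨GIP2017_prop18_corrected_of_prop18 h18, smPos_twoOneCube_of_prop18 h18⟩,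
    fun ⟨h18c, hcube⟩ D lam hl hE => ?_⟩
  by_cases hp : lam.parts = {2, 1, 1, 1}
  · obtain rfl := eq_five_of_parts_eq_two_one_one_one hp
    obtain rfl := eq_twoOneCube_of_parts_eq_two_one_one_one hp
    exact hcube
  · exact h18c D lam hl fun hmem =>
      ((mem_gipExceptionalShapesCorrected_iff _).mp hmem).elim hp hE

/-- **Localisation of the error in Prop. 20**: the printed statement is equivalent to the corrected
one together with the single (false) atom `sm((2,1³), 12) > 0`. [cite: GesmundoIkenmeyerPanova2017, Prop. 20] -/
theorem GIP2017_prop20_iff :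
    GIP2017_prop20 ↔ GIP2017_prop20_corrected ∧ SmPos 12 twoOneCube := by
  refine ⟨fun h20 => ⟨GIP2017_prop20_corrected_of_prop20 h20, smPos_twoOneCube_of_prop20 h20⟩,
    fun ⟨h20c, hcube⟩ D L lam hL hE h22 => ?_⟩
  by_cases hp : lam.parts = {2, 1, 1, 1}
  · obtain rfl := eq_five_of_parts_eq_two_one_one_one hp
    obtain rfl := eq_twoOneCube_of_parts_eq_two_one_one_one hp
    exact hcube.mono (twelve_le_gipEll L)
  · exact h20c D L lam hL (fun hmem =>
      ((mem_gipExceptionalShapesCorrected_iff _).mp hmem).elim hp hE) h22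

/-- Given the `𝔖₅` computation, the printed Prop. 20 and Prop. 18 are refuted while their
corrected forms are untouched: `GIP2017_prop20 ↔ False`. [cite: GesmundoIkenmeyerPanova2017, Prop. 20] [cite: FultonHarrisGTM129, §3.1] -/
theorem GIP2017_prop20_iff_false (h : skTwoOneCubeVanishes) : GIP2017_prop20 ↔ False :=
  ⟨GIP2017_prop20_false h, False.elim⟩

/-! ### 3. Arithmetic of the corrected list -/

/-- Every corrected exceptional shape has largest part `≤ 2` or has `5` boxes and largest part `3`;
in particular none has `λ₁ ≥ 3` and `|λ| ≥ 10` (as used for Prop. 14).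
[cite: GesmundoIkenmeyerPanova2017, §3 (proof of Prop. 14)] -/
theorem sup_le_two_or_sum_eq_five_of_mem_gipExceptionalShapesCorrected {s : Multiset ℕ}
    (h : s ∈ gipExceptionalShapesCorrected) : s.sup ≤ 2 ∨ s.sum = 5 := by
  rcases (mem_gipExceptionalShapesCorrected_iff s).mp h with rfl | h
  · left; decide
  · exact sup_le_two_or_sum_eq_five_of_mem_gipExceptionalShapes h

/-- The corrected exceptional shapes are single columns (largest part `1`) or have their largest
part exactly once. [cite: GesmundoIkenmeyerPanova2017, Prop. 20 (the exceptional list)] -/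
theorem sup_eq_one_or_count_sup_eq_one_of_mem_gipExceptionalShapesCorrected {s : Multiset ℕ}
    (h : s ∈ gipExceptionalShapesCorrected) : s.sup = 1 ∨ s.count s.sup = 1 := by
  rcases (mem_gipExceptionalShapesCorrected_iff s).mp h with rfl | h
  · right; decide
  · exact sup_eq_one_or_count_sup_eq_one_of_mem_gipExceptionalShapes h

/-- The only corrected exceptional shape with exactly two parts is `(1,1)`.
[cite: GesmundoIkenmeyerPanova2017, Prop. 20 (the exceptional list)] -/
theorem sup_eq_one_of_mem_gipExceptionalShapesCorrected_of_card_eq_two {s : Multiset ℕ}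
    (h : s ∈ gipExceptionalShapesCorrected) (h2 : s.card = 2) : s.sup = 1 := by
  rcases (mem_gipExceptionalShapesCorrected_iff s).mp h with rfl | h
  · revert h2; decide
  · exact sup_eq_one_of_mem_gipExceptionalShapes_of_card_eq_two h h2

/-- Single columns in the corrected list are exactly `{1^r : r ∈ X_s}` (`(2,1³)` is not a column).
[cite: GesmundoIkenmeyerPanova2017, Prop. 18] -/
theorem replicate_mem_gipExceptionalShapesCorrected_iff (r : ℕ) :
    Multiset.replicate r 1 ∈ gipExceptionalShapesCorrected ↔ r ∈ gipXs := by
  rw [mem_gipExceptionalShapesCorrected_iff, replicate_mem_gipExceptionalShapes_iff, or_iff_right]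
  intro h
  have h2 : (2 : ℕ) ∈ Multiset.replicate r 1 := by
    rw [h]
    exact Multiset.mem_cons_self _ _
  exact absurd (Multiset.eq_of_mem_replicate h2) (by decide)

/-- **Two or more columns, all of length `≥ 2`, never form a corrected exceptional shape** (largest
part `#columns ≥ 2` occurring at least twice). [cite: GesmundoIkenmeyerPanova2017, §3 (proof of Prop. 20)] -/
theorem parts_ofColumns_not_mem_corrected {S : Multiset ℕ} (h2 : ∀ c ∈ S, 2 ≤ c)
    (hS : 2 ≤ S.card) : (ofColumns S).parts ∉ gipExceptionalShapesCorrected := by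
  intro hmem
  have h0 : (ofColumns S).sortedParts.getD 0 0 = S.card := by
    rw [getD_sortedParts_ofColumns, colCount_eq_card_of_forall_lt fun c hc => by
      have := h2 c hc; omega]
  have h1 : (ofColumns S).sortedParts.getD 1 0 = S.card := by
    rw [getD_sortedParts_ofColumns, colCount_eq_card_of_forall_lt fun c hc => h2 c hc]
  have hsup : (ofColumns S).parts.sup = S.card := by
    rw [sup_parts_eq_getD_sortedParts, h0]
  have hcount := two_le_count_of_getD_eq (ofColumns S) (by omega) h0 h1
  rcases sup_eq_one_or_count_sup_eq_one_of_mem_gipExceptionalShapesCorrected hmem with h | h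
  · rw [hsup] at h
    omega
  · rw [hsup] at h
    omega

/-! ### 4. The corrected Prop. 20 from Props. 15, 17, 18 (corrected), 19 (as printed: vacuous since the verdict clean-up of 2026-08-15, deprecated) -/

-- `linter.deprecated` is switched off for the next declaration only: its hypothesis `h19` is the
-- record `GIP2017_prop19` of `GCTMatrixPoweringColumns.lean`, refuted as printed and deprecated there
-- (verdict clean-up 2026-08-15); this theorem must name it and is deprecated itself.
-- REMOVE-WHEN the record is deleted from `GCTMatrixPoweringColumns.lean`.
set_option linter.deprecated false in
/-- **GIP Prop. 20 (corrected) from its printed ingredients**: Prop. 15 (semigroup, positivity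
form), Prop. 17 (columns), Prop. 18 CORRECTED (small shapes off the ten-shape list) and Prop. 19,
by the printed case analysis on the number `x` of exceptional columns of `λ` exactly as in
`GIP2017_prop20_of_parts`: Prop. 18 is only ever applied to shapes with two or more columns all of
length `≥ 2` (never one of the ten shapes, `parts_ofColumns_not_mem_corrected`), to `(2,1)`, and to
`λ` itself when all its other columns are singletons (then `λ` has at most `12` rows and is off the
ten-shape list by hypothesis — this is where the printed argument silently needs
`λ ≠ (2,1³) = 1⁴ + 1¹`).
**Deprecated (2026-08-15)** together with its hypothesis `GIP2017_prop19`, refuted as printed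
(`GIP2017_prop19_false`, `GCTMatrixPoweringProp19False.lean`), which makes this theorem vacuous;
*content unchanged*. Use `GIP2017_prop20_corrected_of_prop18` (`GCTMatrixPoweringProp17.lean`: this
very case analysis with the corrected, proved Prop. 19) or the unconditional
`GIP2017_prop20_corrected_holds` (`GCTMatrixPoweringProp20Holds.lean`). [cite: GesmundoIkenmeyerPanova2017, Prop. 20 (proof, §3)] -/
@[deprecated "vacuous: the hypothesis GIP2017_prop19 is refuted as printed; use Literature.Barriers.ValiantsHypothesis.GIP2017_prop20_corrected_of_prop18 (GCTMatrixPoweringProp17.lean) or GIP2017_prop20_corrected_holds (GCTMatrixPoweringProp20Holds.lean)" (since := "2026-08-15")]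
theorem GIP2017_prop20_corrected_of_parts (h15 : GIP2017_prop15) (h17 : GIP2017_prop17)
    (h18 : GIP2017_prop18_corrected) (h19 : GIP2017_prop19) : GIP2017_prop20_corrected := by
  intro D L lam hL hE h22
  -- the columns `C` of `λ`, the exceptional ones `X` and the others `A`
  set C := lam.transpose.parts with hC
  have hCpos : ∀ c ∈ C, 1 ≤ c := fun c hc => transpose_parts_pos lam c hc
  have hCL : ∀ c ∈ C, c ≤ L := fun c hc => (le_card_parts_of_mem_transpose lam hc).trans hL
  have hlamC : ∀ r, lam.sortedParts.getD r 0 = colCount C r :=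
    getD_sortedParts_eq_colCount_transpose lam
  have hcardlam : lam.parts.card = C.sup := card_parts_eq_sup_transpose lam
  set X := C.filter (fun c => c ∈ gipXs) with hX
  set A := C.filter (fun c => c ∉ gipXs) with hA
  have hCXA : C = X + A := (Multiset.filter_add_not _ C).symm
  have hAgood : ∀ c ∈ A, 1 ≤ c ∧ c ≤ L ∧ c ∉ gipXs := fun c hc => by
    rw [hA, Multiset.mem_filter] at hc
    exact ⟨hCpos c hc.1, hCL c hc.1, hc.2⟩
  have hXs : ∀ c ∈ X, c ∈ gipXs := fun c hc => by
    rw [hX, Multiset.mem_filter] at hc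
    exact hc.2
  have hXge : ∀ c ∈ X, 2 ≤ c ∧ c ≤ 12 := fun c hc => by
    have h := hXs c hc
    simp only [gipXs, Finset.mem_insert, Finset.mem_singleton] at h
    omega
  -- the tools
  have h12 : 12 ≤ gipEll L := twelve_le_gipEll L
  have combine : ∀ {c a b : ℕ} {lam' : Nat.Partition c} {mu : Nat.Partition a}
      {nu : Nat.Partition b},
      IsRowSum lam' mu nu → SmPos (gipEll L) mu → SmPos (gipEll L) nu → SmPos (gipEll L) lam' :=
    fun hrs hmu hnu => (h15 (gipEll L) (gipEll_pos L) _ _ _ hrs).1 hmu hnu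
  have good : ∀ S : Multiset ℕ, S ≤ A → SmPos (gipEll L) (ofColumns S) := fun S hS =>
    smPos_ofColumns h15 h17 S fun c hc => hAgood c (Multiset.mem_of_le hS hc)
  have small : ∀ {c : ℕ} (nu : Nat.Partition c), nu.parts.card ≤ 14 →
      nu.parts ∉ gipExceptionalShapesCorrected → SmPos (gipEll L) nu :=
    fun nu h1 h2 => (h18 _ nu h1 h2).mono (by omega)
  -- case analysis on the number of exceptional columns
  rcases Nat.lt_or_ge X.card 2 with hx | hx
  · rcases Nat.lt_or_ge X.card 1 with hx0 | hx1
    · -- `x = 0`: all columns are good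
      have hX0 : X = 0 := Multiset.card_eq_zero.mp (by omega)
      have hrs : IsRowSum lam (ofColumns X) (ofColumns A) := isRowSum_ofColumns lam hCXA
      refine combine hrs ?_ (good A le_rfl)
      exact smPos_of_eq_zero (by rw [hX0, Multiset.sum_zero]) _ _
    · -- `x = 1`: one exceptional column of length `r`
      obtain ⟨r, hXr⟩ := Multiset.card_eq_one.mp (by omega : X.card = 1)
      have hr : r ∈ gipXs := hXs r (by rw [hXr]; exact Multiset.mem_singleton_self r)
      have hr2 : 2 ≤ r ∧ r ≤ 12 := hXge r (by rw [hXr]; exact Multiset.mem_singleton_self r)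
      -- there is another column; let `k` be the longest one
      have hA0 : A ≠ 0 := by
        intro hA0
        apply hE
        have hCr : C = {r} := by rw [hCXA, hXr, hA0, add_zero]
        have hparts : lam.parts = (Nat.Partition.column r).parts :=
          parts_eq_of_getD_sortedParts_eq fun i => by rw [hlamC, hCr, getD_sortedParts_column]
        rw [hparts, Nat.Partition.column_parts]
        exact (replicate_mem_gipExceptionalShapesCorrected_iff r).mpr hr
      set k := A.sup with hk
      have hkA : k ∈ A := sup_mem_of_ne_zero hA0
      obtain ⟨hk1, hkL, hks⟩ := hAgood k hkA
      have hAle : ∀ c ∈ A, c ≤ k := fun c hc => Multiset.le_sup hc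
      set A' := A.erase k with hA'
      have hAk : A = k ::ₘ A' := (Multiset.cons_erase hkA).symm
      have hA'le : A' ≤ A := Multiset.erase_le k A
      have hCk : C = ({k} + {r}) + A' := by
        rw [hCXA, hXr, hAk, ← Multiset.singleton_add]
        abel
      -- the hook case: all other columns are singletons, `λ` itself is small
      have hook : k = 1 → SmPos (gipEll L) lam := by
        intro hk1'
        refine small lam ?_ hE
        rw [hcardlam, Multiset.sup_le]
        intro c hc
        rw [hCXA, Multiset.mem_add] at hc
        rcases hc with hc | hc
        · exact (hXge c hc).2.trans (by norm_num)
        · exact (hAle c hc).trans (by omega)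
      by_cases hr_two : r = 2
      · -- the exceptional column has length `2`
        subst hr_two
        rcases Nat.lt_or_ge k 2 with hk_lt | hk_ge
        · exact hook (by omega)
        by_cases hA'0 : A' = 0
        · -- `λ = (2,2,1^{k-2})` is excluded
          exfalso
          apply h22 (k - 2)
          have hCk2 : C = {k - 2 + 2, 2} := by
            rw [hCk, hA'0, add_zero, Multiset.insert_eq_cons, ← Multiset.singleton_add,
              Nat.sub_add_cancel hk_ge]
          have hparts : lam.parts = (twoTwoCol (k - 2)).parts :=
            parts_eq_of_getD_sortedParts_eq fun i => by rw [hlamC, hCk2, getD_sortedParts_twoTwoCol]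
          rw [hparts, twoTwoCol_parts]
        rcases Nat.lt_or_ge 14 k with hk14 | hk14
        · -- `k > 14`: Prop. 19 on `(2,2,1^{k-2})`, whose rows are those of the columns `k, 2`
          have hrows : ∀ i, (twoTwoCol (k - 2)).sortedParts.getD i 0 = colCount ({k} + {2}) i := by
            intro i
            rw [getD_sortedParts_twoTwoCol, Nat.sub_add_cancel hk_ge, Multiset.insert_eq_cons,
              ← Multiset.singleton_add]
          have hbound : max 7 (Nat.sqrt (k - 2 + 1) + 1) ≤ gipEll L :=
            max_seven_sqrt_le_gipEll hk_ge hkL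
          rcases h19 (k - 2) with hsm | ham
          · -- `sm((2,2,1^{k-2}), ℓ) > 0`: add the remaining columns
            have hrs : IsRowSum lam (twoTwoCol (k - 2)) (ofColumns A') :=
              isRowSum_of_colCount (fun i => by rw [hlamC, hCk]) hrows
                (getD_sortedParts_ofColumns A')
            exact combine hrs (hsm.mono hbound) (good A' hA'le)
          · -- `am((2,2,1^{k-2}), ℓ) > 0`: a second long column `k₂` with `am(1^{k₂}, ℓ) > 0`
            set k₂ := A'.sup with hk₂
            have hk₂A' : k₂ ∈ A' := sup_mem_of_ne_zero hA'0
            obtain ⟨hk₂1, hk₂L, hk₂s⟩ := hAgood k₂ (Multiset.mem_of_le hA'le hk₂A')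
            set A'' := A'.erase k₂ with hA''
            have hA'k : A' = k₂ ::ₘ A'' := (Multiset.cons_erase hk₂A').symm
            have hA''le : A'' ≤ A := (Multiset.erase_le k₂ A').trans hA'le
            rcases Nat.lt_or_ge 14 k₂ with hk₂14 | hk₂14
            · have hk₂a : k₂ ∉ gipXa := by
                simp only [gipXa, Finset.mem_insert, Finset.mem_singleton]
                omega
              -- `δ` = columns `k, 2, k₂`
              have hδ : IsRowSum (ofColumns (({k} + {2}) + {k₂})) (twoTwoCol (k - 2))
                  (Nat.Partition.column k₂) :=
                isRowSum_of_colCount (getD_sortedParts_ofColumns _) hrows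
                  (getD_sortedParts_column k₂)
              have hδpos : SmPos (gipEll L) (ofColumns (({k} + {2}) + {k₂})) :=
                (h15 (gipEll L) (gipEll_pos L) _ _ _ hδ).2.1 (ham.mono hbound)
                  (amPos_column h17 hk₂1 hk₂L hk₂a)
              have hCk' : C = (({k} + {2}) + {k₂}) + A'' := by
                rw [hCk, hA'k, ← Multiset.singleton_add]
                abel
              have hrs : IsRowSum lam (ofColumns (({k} + {2}) + {k₂})) (ofColumns A'') :=
                isRowSum_of_colCount (fun i => by rw [hlamC, hCk']) (getD_sortedParts_ofColumns _)
                  (getD_sortedParts_ofColumns A'')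
              exact combine hrs hδpos (good A'' hA''le)
            · -- `k₂ ≤ 14`: Prop. 18 on the columns `k₂, 2`
              have hγsmall : SmPos (gipEll L) (ofColumns ({k₂} + {2})) := by
                refine small _ ?_ ?_
                · rw [card_parts_ofColumns, Multiset.sup_add, Multiset.sup_singleton,
                    Multiset.sup_singleton]
                  exact sup_le hk₂14 (by norm_num)
                · rcases Nat.lt_or_ge k₂ 2 with hk₂lt | hk₂ge
                  · -- the shape `(2,1)`: two parts, largest part `2`
                    intro hmem
                    have hk₂one : k₂ = 1 := by omega
                    have hcard : (ofColumns ({k₂} + {2})).parts.card = 2 := by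
                      rw [card_parts_ofColumns, Multiset.sup_add, Multiset.sup_singleton,
                        Multiset.sup_singleton, hk₂one]
                      decide
                    have hsup : (ofColumns ({k₂} + {2})).parts.sup = 2 := by
                      rw [sup_parts_ofColumns]
                      · simp
                      · intro c hc
                        simp only [Multiset.mem_add, Multiset.mem_singleton] at hc
                        omega
                    have :=
                      sup_eq_one_of_mem_gipExceptionalShapesCorrected_of_card_eq_two hmem hcard
                    omega
                  · exact parts_ofColumns_not_mem_corrected (fun c hc => by
                      simp only [Multiset.mem_add, Multiset.mem_singleton] at hc; omega) (by simp)
              have hCk' : C = ({k₂} + {2}) + ({k} + A'') := by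
                rw [hCk, hA'k, ← Multiset.singleton_add]
                abel
              have hrs : IsRowSum lam (ofColumns ({k₂} + {2})) (ofColumns ({k} + A'')) :=
                isRowSum_of_colCount (fun i => by rw [hlamC, hCk']) (getD_sortedParts_ofColumns _)
                  (getD_sortedParts_ofColumns _)
              refine combine hrs hγsmall (good _ ?_)
              rw [Multiset.singleton_add, hAk]
              exact Multiset.cons_le_cons k (Multiset.erase_le k₂ A')
        · -- `2 ≤ k ≤ 14`: Prop. 18 on the columns `k, 2` (a shape with two columns `≥ 2`)
          have hγsmall : SmPos (gipEll L) (ofColumns ({k} + {2})) := by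
            refine small _ ?_ (parts_ofColumns_not_mem_corrected (fun c hc => by
              simp only [Multiset.mem_add, Multiset.mem_singleton] at hc; omega) (by simp))
            rw [card_parts_ofColumns, Multiset.sup_add, Multiset.sup_singleton,
              Multiset.sup_singleton]
            exact sup_le hk14 (by norm_num)
          have hrs : IsRowSum lam (ofColumns ({k} + {2})) (ofColumns A') :=
            isRowSum_of_colCount (fun i => by rw [hlamC, hCk]) (getD_sortedParts_ofColumns _)
              (getD_sortedParts_ofColumns A')
          exact combine hrs hγsmall (good A' hA'le)
      · -- the exceptional column has length `r ≠ 2`, so `r ∉ X_a`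
        have hra : r ∉ gipXa := by
          simp only [gipXs, Finset.mem_insert, Finset.mem_singleton] at hr
          simp only [gipXa, Finset.mem_insert, Finset.mem_singleton]
          omega
        by_cases hka : k ∈ gipXa
        · rcases Nat.lt_or_ge k 2 with hk_lt | hk_ge
          · exact hook (by omega)
          · -- `k ∈ X_a`, `k ≥ 2`: Prop. 18 on the columns `k, r` (both `≥ 2`, `k ≤ 14`)
            have hk14 : k ≤ 14 := by
              simp only [gipXa, Finset.mem_insert, Finset.mem_singleton] at hka
              omega
            have hγsmall : SmPos (gipEll L) (ofColumns ({k} + {r})) := by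
              refine small _ ?_ (parts_ofColumns_not_mem_corrected (fun c hc => by
                simp only [Multiset.mem_add, Multiset.mem_singleton] at hc; omega) (by simp))
              rw [card_parts_ofColumns, Multiset.sup_add, Multiset.sup_singleton,
                Multiset.sup_singleton]
              exact sup_le hk14 (by omega)
            have hrs : IsRowSum lam (ofColumns ({k} + {r})) (ofColumns A') :=
              isRowSum_of_colCount (fun i => by rw [hlamC, hCk]) (getD_sortedParts_ofColumns _)
                (getD_sortedParts_ofColumns A')
            exact combine hrs hγsmall (good A' hA'le)
        · -- `k ∉ X_a`: `am(1^k, ℓ), am(1^r, ℓ) > 0`, so `sm(1^k + 1^r, ℓ) > 0` by Prop. 15(2)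
          have hγ : IsRowSum (ofColumns ({k} + {r})) (Nat.Partition.column k)
              (Nat.Partition.column r) :=
            isRowSum_of_colCount (getD_sortedParts_ofColumns _) (getD_sortedParts_column k)
              (getD_sortedParts_column r)
          have hrC : r ∈ C := by
            rw [hCXA, hXr]
            exact Multiset.mem_add.mpr (Or.inl (Multiset.mem_singleton_self r))
          have hγpos : SmPos (gipEll L) (ofColumns ({k} + {r})) :=
            (h15 (gipEll L) (gipEll_pos L) _ _ _ hγ).2.1 (amPos_column h17 hk1 hkL hka)
              (amPos_column h17 (by omega) (hCL r hrC) hra)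
          have hrs : IsRowSum lam (ofColumns ({k} + {r})) (ofColumns A') :=
            isRowSum_of_colCount (fun i => by rw [hlamC, hCk]) (getD_sortedParts_ofColumns _)
              (getD_sortedParts_ofColumns A')
          exact combine hrs hγpos (good A' hA'le)
  · -- `x ≥ 2`: Prop. 18 on the exceptional columns, Prop. 17 + 15(1) on the others
    have hβsmall : SmPos (gipEll L) (ofColumns X) := by
      refine small _ ?_ (parts_ofColumns_not_mem_corrected (fun c hc => (hXge c hc).1) hx)
      rw [card_parts_ofColumns, Multiset.sup_le]
      exact fun c hc => (hXge c hc).2.trans (by norm_num)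
    exact combine (isRowSum_ofColumns lam hCXA) hβsmall (good A le_rfl)

/-! ### 5. Prop. 14, Thm. 10 and the barrier fact from the corrected chain -/

/-- **Prop. 14 from the corrected Prop. 20** (GIP p. 12: `λ₁ ≥ 3` excludes the one- and two-column
exceptions — all ten corrected shapes have `λ₁ ≤ 2` except `(3,1,1)`, excluded by `|λ| = md ≥ 10` —
and `ℓ(m²) = m + 2 ≤ n`). [cite: GesmundoIkenmeyerPanova2017, Prop. 14 (proof from Prop. 20, §3)] -/
theorem GIP2017_prop14_of_prop20_corrected (h20 : GIP2017_prop20_corrected) : GIP2017_prop14 := by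
  intro n m d hn hd lam hsup hlen hnm
  have hsum : lam.parts.sum = d * n := lam.parts_sum
  have hdn : 10 ≤ d * n := le_trans hn (Nat.le_mul_of_pos_left n hd)
  have hexc : lam.parts ∉ gipExceptionalShapesCorrected := by
    intro hmem
    rcases sup_le_two_or_sum_eq_five_of_mem_gipExceptionalShapesCorrected hmem with h2 | h5
    · omega
    · omega
  have h22 : ∀ k : ℕ, lam.parts ≠ 2 ::ₘ 2 ::ₘ Multiset.replicate k 1 := by
    intro k hk
    have hle : (2 ::ₘ 2 ::ₘ Multiset.replicate k 1).sup ≤ 2 := by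
      rw [Multiset.sup_cons, Multiset.sup_cons]
      refine max_le le_rfl (max_le le_rfl (Multiset.sup_le.mpr fun b hb => ?_))
      rw [Multiset.eq_of_mem_replicate hb]
      exact one_le_two
    rw [← hk] at hle
    omega
  have h := h20 (d * n) (n ^ 2) lam hlen hexc h22
  rw [gipEll_sq hn] at h
  exact h.mono hnm

/-- **GIP Thm. 10 from the corrected Prop. 20.** [cite: GesmundoIkenmeyerPanova2017, Thm. 10 (proof, pp. 7 and 12)] -/
theorem GIP2017_thm10_of_prop20_corrected (h20 : GIP2017_prop20_corrected) : GIP2017_thm10 :=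
  GIP2017_thm10_of_prop14 (GIP2017_prop14_of_prop20_corrected h20)

/-- The barrier fact `GCTMatrixPowering` (= Thm. 10) from the corrected Prop. 20.
[cite: GesmundoIkenmeyerPanova2017, Thm. 10] -/
theorem gctMatrixPowering_of_prop20_corrected (h20 : GIP2017_prop20_corrected) : GCTMatrixPowering :=
  GIP2017_thm10_of_prop20_corrected h20

-- `linter.deprecated` off for the next declaration only: it names the refuted, deprecated record
-- `GIP2017_prop19` (and the deprecated `GIP2017_prop20_corrected_of_parts`) and is deprecated
-- itself. REMOVE-WHEN the record is deleted from `GCTMatrixPoweringColumns.lean`.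
set_option linter.deprecated false in
/-- **GIP Thm. 10 from Props. 15, 17, 18 (corrected), 19.** **Deprecated (2026-08-15)**: vacuous,
its hypothesis `GIP2017_prop19` being refuted as printed (`GIP2017_prop19_false`); use
`GIP2017_thm10_of_prop18` (`GCTMatrixPoweringProp17.lean`) or the unconditional
`GCTMatrixPowering_holds` (`GCTMatrixPoweringProp20Holds.lean`). [cite: GesmundoIkenmeyerPanova2017, Thm. 10 (proof) and §3] -/
@[deprecated "vacuous: the hypothesis GIP2017_prop19 is refuted as printed; use Literature.Barriers.ValiantsHypothesis.GIP2017_thm10_of_prop18 (GCTMatrixPoweringProp17.lean) or GCTMatrixPowering_holds (GCTMatrixPoweringProp20Holds.lean)" (since := "2026-08-15")]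
theorem GIP2017_thm10_of_parts_corrected (h15 : GIP2017_prop15) (h17 : GIP2017_prop17)
    (h18 : GIP2017_prop18_corrected) (h19 : GIP2017_prop19) : GIP2017_thm10 :=
  GIP2017_thm10_of_prop20_corrected (GIP2017_prop20_corrected_of_parts h15 h17 h18 h19)

-- `linter.deprecated` off for the next declaration only (same reason); REMOVE-WHEN as above.
set_option linter.deprecated false in
/-- The barrier fact `GCTMatrixPowering` from Props. 15, 17, 18 (corrected), 19: its trust base
after the first erratum. **Deprecated (2026-08-15)**: vacuous, its hypothesis `GIP2017_prop19`
being refuted as printed (second erratum, `GIP2017_prop19_false`); use `gctMatrixPowering_of_prop18`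
(`GCTMatrixPoweringProp17.lean`) or the unconditional `GCTMatrixPowering_holds`
(`GCTMatrixPoweringProp20Holds.lean`). [cite: GesmundoIkenmeyerPanova2017, Thm. 10] -/
@[deprecated "vacuous: the hypothesis GIP2017_prop19 is refuted as printed; use Literature.Barriers.ValiantsHypothesis.gctMatrixPowering_of_prop18 (GCTMatrixPoweringProp17.lean) or GCTMatrixPowering_holds (GCTMatrixPoweringProp20Holds.lean)" (since := "2026-08-15")]
theorem gctMatrixPowering_of_parts_corrected (h15 : GIP2017_prop15) (h17 : GIP2017_prop17)
    (h18 : GIP2017_prop18_corrected) (h19 : GIP2017_prop19) : GCTMatrixPowering :=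
  GIP2017_thm10_of_parts_corrected h15 h17 h18 h19

end Literature.Barriers.ValiantsHypothesis

end
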